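import Literature.NumberTheory.Automorphic.Liu2021.SplitPlaceOscillatorModelProofs
import Literature.NumberTheory.Automorphic.Zelevinsky1980.UnitaryCharacterInductionIrreducible
import HarnessLib

/-!
# [Liu2021, App. D, proof of Lem. D.1, first paragraph] — the split-place model, UNIFORM in `χ`, and the named fact
# `splitPlace_chiCoinv_iso_parabolicIndGL` DISCHARGED

Topic `NumberTheory/Automorphic/Liu2021`; namespace `Literature.NumberTheory.Automorphic.Liu2021`.  KERNEL ONLY: theorems; no
definition, no named fact, no `sorry`.

* `splitPlace_chiCoinv_iso_parabolicIndGL_uniform` — the split-place model with `∃ ν` BEFORE `∀ χ`: for every smooth unitary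
  section `s` at a split place there is ONE unitary continuous `ν` of `E_wˣ` (namely `ν = ν_K ∘ ι_w⁻¹`, `η_s ∘ φ = ν_K ∘ det` the
  character of the mixed model of `ω_s`) such that for EVERY unitary continuous character `χ` of the centre `U(J₁)(F_v)` the
  `χ`-coinvariants of `ω_s` are `GL_N(E_w)`-isomorphic to `Ind_{Q_{N-1,1}}^{GL_N}((ν∘det) ⊠ χ′ν^{1-N})` for some unitary continuous
  `χ′` (the shape `hM` consumed by `rankOne_theta_twist_rigidity_split_of_uniformModel`).  Same assembly as
  `splitPlace_chiCoinv_iso_parabolicIndGL_of_isIrreducible` (module `SplitPlaceOscillatorModelProofs`), re-ordered so that `ν` is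
  produced before `χ` enters, with the irreducibility input [Zelevinsky1980, Thm. 4.2] now PROVED in the tree
  (`Zelevinsky1980.parabolicIndGL_detChar_unitary_isIrreducible_holds`).
* `splitPlace_chiCoinv_iso_parabolicIndGL_holds` — the named fact `splitPlace_chiCoinv_iso_parabolicIndGL` HOLDS (unconditional).

HC_CM is NOT proved by anything here.
-/

set_option autoImplicit false

noncomputable section

open NumberField IsDedekindDomain Matrix
open _root_.MeasureTheory
open scoped MatrixGroups
open Literature.RepresentationTheory (TwistedCoinv.rep TwistedCoinv.Coinv TwistedCoinv.mk TwistedCoinv.ker TwistedCoinv.mapEquiv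
  TwistedCoinv.mapEquiv_rep TwistedCoinv.mk_surjective TwistedCoinv.rep_mk TwistedCoinv.mapEquiv_mk)
open Literature.RepresentationTheory.HeisenbergGroup (MpPsi leviOpPi)
open Literature.RepresentationTheory.HeisenbergGroup.SymplecticMatrix (glEquiv)
open Literature.NumberTheory.GelbartRogawski1991.UnitaryDualPair.LocalSplitting (iota LocalMp localSchrodinger toPlace_splitCoord)
open Literature.NumberTheory.Automorphic.Zelevinsky1980 (lastBlockLabel maxParabolicLeviChar parabolicIndGL_detChar_unitary_isIrreducible
  parabolicIndGL_detChar_unitary_isIrreducible_holds)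
open Literature.NumberTheory.Automorphic.UnitaryGroup

namespace Literature.NumberTheory.Automorphic.Liu2021

set_option maxHeartbeats 2000000 in -- a long assembly: ~40 intermediate facts over heavy types (`SchwartzBruhat`, `U(J)(F_v)`)
/-- **[Liu2021, App. D, proof of Lemma D.1, first paragraph, p. 126] — the split-place model, uniformly in `χ`**:
`∃ ν` (unitary, continuous; `ν = ν_K ∘ ι_w⁻¹` with `η_s ∘ φ = ν_K ∘ det`) BEFORE `∀ χ`; for each unitary continuous `χ` of
`U(J₁)(F_v)` the representation of `GL_N(E_w)` on the `χ`-coinvariants of `ω_s` is `AreIsomorphicRep` to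
`parabolicIndGL E_w (lastBlockLabel N) ((ν∘det) ⊠ χ′ν^{1-N})` with `χ′ = χ ∘ T_c⁻¹ ∘ ι_w⁻¹`.
[cite: Liu2021, App. D, proof of Lemma D.1 (first paragraph), p. 126; MoeglinVignerasWaldspurger1987, Chap. 3 III.7 a)] -/
theorem splitPlace_chiCoinv_iso_parabolicIndGL_uniform :
    ∀ (F : Type) [Field F] [NumberField F] (E : Type) [Field E] [NumberField E] [Algebra F E]
    [Algebra.IsQuadraticExtension F E] (c : E ≃ₐ[F] E) (hc1 : c ≠ 1) (N : ℕ) (hN : 2 ≤ N) (δ : E) (hcδ : c δ = -δ)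
    (hδ : δ ≠ 0) (d : F) (hd : δ * δ = algebraMap F E d) (T : Matrix (Fin N) (Fin N) F) (hT : T.IsSymm) (hTd : IsUnit T.det)
    (J : Matrix (Fin N) (Fin N) E) (hJ : J = T.map (algebraMap F E)) (hJh : (J.map c)ᵀ = J)
    (v : HeightOneSpectrum (𝓞 F)) (w : UnitaryGroup.PlacesOver E v) (hw : c • (w : HeightOneSpectrum (𝓞 E)) ≠ w)
    (hJw : IsUnit (UnitaryGroup.placeForm J (w : HeightOneSpectrum (𝓞 E))))
    [MeasurableSpace (v.adicCompletion F)] [BorelSpace (v.adicCompletion F)]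
    (μX : Measure (Fin N → v.adicCompletion F)) [μX.IsAddHaarMeasure]
    (s : UnitaryGroup.localPi E c N J v →* LocalMp F N T v)
    (hs : ∀ g, MpPsi.proj _ (s g) = iota F E c N hcδ hδ hd T hT hJ v g)
    (hsm : Representation.IsSmooth ((MpPsi.toRep (localSchrodinger F N T v)).comp s))
    (hsu : Representation.IsL2Isometric μX ((MpPsi.toRep (localSchrodinger F N T v)).comp s))
    (J₁ : Matrix (Fin 1) (Fin 1) E) (hJ₁ : J₁ 0 0 ≠ 0)
    [LocallyCompactSpace (standardParabolicGL ((w : HeightOneSpectrum (𝓞 E)).adicCompletion E)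
      (Zelevinsky1980.lastBlockLabel N))],
    ∃ ν : ((w : HeightOneSpectrum (𝓞 E)).adicCompletion E)ˣ →* ℂˣ,
      (∀ x, ‖((ν x : ℂˣ) : ℂ)‖ = 1) ∧ (Continuous fun x => ((ν x : ℂˣ) : ℂ)) ∧
      ∀ (χ : UnitaryGroup.localPi E c 1 J₁ v →* ℂˣ) (hχu : ∀ z, ‖((χ z : ℂˣ) : ℂ)‖ = 1)
        (hχc : Continuous fun z => ((χ z : ℂˣ) : ℂ)),
        ∃ χ' : ((w : HeightOneSpectrum (𝓞 E)).adicCompletion E)ˣ →* ℂˣ,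
          (∀ x, ‖((χ' x : ℂˣ) : ℂ)‖ = 1) ∧ (Continuous fun x => ((χ' x : ℂˣ) : ℂ)) ∧
          AreIsomorphicRep
            ((TwistedCoinv.rep
              (ρW := show Representation ℂ (UnitaryGroup.localPi E c 1 J₁ v) (SchwartzBruhat (Fin N → v.adicCompletion F)) from
                ((MpPsi.toRep (localSchrodinger F N T v)).comp s).comp (UnitaryGroup.localCenter E c N J J₁ hJ₁ v))
              χ ((MpPsi.toRep (localSchrodinger F N T v)).comp s)
              (fun g z => (show Commute g (UnitaryGroup.localCenter E c N J J₁ hJ₁ v z) from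
                UnitaryGroup.localCenter_comm E c N J J₁ hJ₁ v z g).map ((MpPsi.toRep (localSchrodinger F N T v)).comp s))).comp
              (UnitaryGroup.localPiSplitEquiv c J hc1 hJh w hw hJw).symm.toMonoidHom)
            (Representation.parabolicIndGL ((w : HeightOneSpectrum (𝓞 E)).adicCompletion E) (Zelevinsky1980.lastBlockLabel N)
              ((Representation.trivial ℂ (Π a : Bool, GL {i : Fin N // Zelevinsky1980.lastBlockLabel N i = a}
                  ((w : HeightOneSpectrum (𝓞 E)).adicCompletion E)) ℂ).twist
                (Zelevinsky1980.maxParabolicLeviChar ((w : HeightOneSpectrum (𝓞 E)).adicCompletion E) N ν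
                  (χ' * ν ^ (1 - (N : ℤ)))))) := by
  intro F _ _ E _ _ _ _ c hc1 N hN δ hcδ hδ d hd T hT hTd J hJ hJh v w hw hJw _ _ μX _ s hs hsm hsu J₁ hJ₁ _
  classical
  -- notation
  haveI : BorelSpace (v.adicCompletion F)ˣ := Units.borelSpace
  haveI hNE : Nonempty (Fin N) := ⟨⟨0, by omega⟩⟩
  have hN1 : 1 ≤ N := by omega
  -- §A the mixed model
  let μ' : Measure (v.adicCompletion F) := Measure.addHaar
  have hμinst : μ'.IsAddHaarMeasure := inferInstance
  have hmm := @SplitPlaceMixedModel.exists_mixedModel F _ _ E _ _ _ _ c N δ hcδ hδ d hd T hT hTd J hJ v hc1 hJh w hw hJw _ _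
    μ' hμinst s
  have hmm' := hmm hs
  obtain ⟨Γ, η, hΓi, hmodel⟩ := hmm'
  clear hmm
  have hηu := SplitPlaceMixedModel.norm_eq_one_of_mixedModel F E c N T v hc1 hJh w hw hJw μ' s Γ η hΓi hmodel μX hsu
  have hηo := SplitPlaceMixedModel.isOpen_ker_of_mixedModel F E c N J v hc1 hJh w hw hJw s hsm Γ η hmodel
  have hφex := SplitPlaceMixedModel.exists_continuousMulEquiv_symm_map F E c N J v hc1 hJh w hw hJw
  obtain ⟨φ, hφ⟩ := hφex
  -- §B `η ∘ φ = ν_K ∘ det`, `ν_K` unitary with open kernel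
  have hνKex := Literature.LinearAlgebra.Matrix.GLAbelianization.existsUnique_eq_comp_det_of_infinite
    (η.comp φ.toMulEquiv.toMonoidHom)
  obtain ⟨νK, hνK, -⟩ := hνKex
  have hdsecex := exists_continuous_det_section (K := v.adicCompletion F) (⟨0, by omega⟩ : Fin N)
  obtain ⟨dsec, hdsec_cont, hdsec_det⟩ := hdsecex
  have hνK_apply : ∀ a : GL (Fin N) (v.adicCompletion F), η (φ a) = νK (Matrix.GeneralLinearGroup.det a) := fun a => by
    have := DFunLike.congr_fun hνK a
    exact this
  have hνKd : ∀ t, νK t = η (φ (dsec t)) := fun t => by rw [hνK_apply, hdsec_det]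
  have hνKu : ∀ t, ‖((νK t : ℂˣ) : ℂ)‖ = 1 := fun t => by rw [hνKd, hφ]; exact hηu _
  have hνKo : IsOpen (νK.ker : Set (v.adicCompletion F)ˣ) := by
    have : (νK.ker : Set (v.adicCompletion F)ˣ) = (fun t => φ (dsec t)) ⁻¹' (η.ker : Set (localPi E c N J v)) := by
      ext t
      simp only [SetLike.mem_coe, MonoidHom.mem_ker, Set.mem_preimage, hνKd]
    rw [this]
    exact hηo.preimage (φ.continuous.comp hdsec_cont)
  -- §C the conjugated representation `π_K = Γ ω_s(φ ·) Γ⁻¹` of `GL_N(F_v)`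
  have hπKex : ∃ πK : Representation ℂ (GL (Fin N) (v.adicCompletion F)) (SchwartzBruhat (Fin N → v.adicCompletion F)),
      ∀ a Ψ, πK a Ψ = Γ ((MpPsi.toRep (localSchrodinger F N T v)).comp s (φ a) (Γ.symm Ψ)) := by
    refine ⟨{ toFun := fun a => Γ.toLinearMap ∘ₗ (MpPsi.toRep (localSchrodinger F N T v)).comp s (φ a) ∘ₗ Γ.symm.toLinearMap
              map_one' := ?_
              map_mul' := fun a b => ?_ }, fun a Ψ => rfl⟩
    · apply LinearMap.ext; intro Ψ
      simp only [map_one, LinearMap.coe_comp, LinearEquiv.coe_coe, Function.comp_apply, Module.End.one_apply,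
        LinearEquiv.apply_symm_apply]
    · apply LinearMap.ext; intro Ψ
      simp only [map_mul, LinearMap.coe_comp, LinearEquiv.coe_coe, Function.comp_apply, Module.End.mul_apply,
        LinearEquiv.symm_apply_apply]
  obtain ⟨πK, hπK⟩ := hπKex
  have hπK_model : ∀ (a : GL (Fin N) (v.adicCompletion F)) (Ψ : SchwartzBruhat (Fin N → v.adicCompletion F)),
      πK a Ψ = ((νK (Matrix.GeneralLinearGroup.det a) : ℂˣ) : ℂ) • leviOpPi (glEquiv (GLn.contragredient a)) Ψ := by
    intro a Ψ
    rw [hπK, ← hνK_apply, hφ, hmodel, map_smul, LinearEquiv.apply_symm_apply, LinearEquiv.apply_symm_apply]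
  have hπKs : πK.IsSmooth := by
    intro Ψ
    refine Subgroup.isOpen_mono (H₁ := (Representation.stabilizerSubgroup ((MpPsi.toRep (localSchrodinger F N T v)).comp s)
      (Γ.symm Ψ)).comap φ.toMulEquiv.toMonoidHom) ?_ ((hsm (Γ.symm Ψ)).preimage φ.continuous)
    intro a ha
    rw [Subgroup.mem_comap, Representation.mem_stabilizerSubgroup] at ha
    rw [Representation.mem_stabilizerSubgroup, hπK]
    have ha' : (MpPsi.toRep (localSchrodinger F N T v)).comp s (φ a) (Γ.symm Ψ) = Γ.symm Ψ := ha
    rw [ha', LinearEquiv.apply_symm_apply]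
  have hcomm : ∀ (g : GL (Fin N) (v.adicCompletion F)) (t : (v.adicCompletion F)ˣ),
      Commute (πK g) ((πK.comp (Units.map (Matrix.scalar (Fin N)).toMonoidHom)) t) := by
    intro g t
    change πK g * πK (Units.map (Matrix.scalar (Fin N)).toMonoidHom t) = πK (Units.map (Matrix.scalar (Fin N)).toMonoidHom t) * πK g
    rw [← map_mul, ← map_mul, SchwartzPiLine.scalar_mul_comm]
  have hνKc : Continuous fun t => ((νK t : ℂˣ) : ℂ) :=
    Units.continuous_val.comp (continuous_of_isOpen_ker νK hνKo)
  -- §G transport `F_v = E_w` along `ι_w`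
  have hef := ramificationIdx_eq_one_and_inertiaDeg_eq_one_of_smul_ne F c hw
  obtain ⟨he1, hf1⟩ := hef
  haveI := UnitaryGroup.PlacesOver.liesOver w
  have hιex : ∃ ι : v.adicCompletion F ≃+* w.1.adicCompletion E, (∀ x, ι x = toPlace v w x) ∧ Continuous ι ∧
      Continuous ι.symm :=
    ⟨adicCompletionEquivOfDegreeOne F E v w.1 he1 hf1, fun _ => rfl,
      continuous_adicCompletionEquivOfDegreeOne F E v w.1 he1 hf1,
      continuous_adicCompletionEquivOfDegreeOne_symm F E v w.1 he1 hf1⟩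
  obtain ⟨ιw, hιw, hιc, hιc'⟩ := hιex
  have hνex : ∃ ν : (w.1.adicCompletion E)ˣ →* ℂˣ,
      ν = νK.comp (Units.map (ιw.symm : w.1.adicCompletion E →+* v.adicCompletion F).toMonoidHom) := ⟨_, rfl⟩
  obtain ⟨ν, hν⟩ := hνex
  have hmap_symm : ∀ t : (v.adicCompletion F)ˣ,
      Units.map (ιw.symm : w.1.adicCompletion E →+* v.adicCompletion F).toMonoidHom
        (Units.map (ιw : v.adicCompletion F →+* w.1.adicCompletion E).toMonoidHom t) = t := fun t =>
    Units.ext (ιw.symm_apply_apply (t : v.adicCompletion F))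
  have hν_apply : ∀ t, ν (Units.map (ιw : v.adicCompletion F →+* w.1.adicCompletion E).toMonoidHom t) = νK t :=
    fun t => by rw [hν, MonoidHom.comp_apply, hmap_symm]
  have e1 : ν.comp (Units.map (ιw : v.adicCompletion F →+* w.1.adicCompletion E).toMonoidHom) = νK :=
    MonoidHom.ext fun t => by rw [MonoidHom.comp_apply, hν_apply]
  -- unitarity and continuity of `ν`
  have hνu : ∀ x, ‖((ν x : ℂˣ) : ℂ)‖ = 1 := fun x => by rw [hν]; exact hνKu _
  have hνc : Continuous fun x => ((ν x : ℂˣ) : ℂ) := by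
    rw [hν]; exact hνKc.comp (Continuous.units_map _ hιc')
  refine ⟨ν, hνu, hνc, fun χ hχu hχc => ?_⟩
  -- §D the centre `T_c : U(J₁)(F_v) ≃* F_vˣ`, the character `χ_K = χ ∘ T_c⁻¹`, and `localCenter z = φ (T_c z • 1)`
  have hTcex := SplitPlaceMixedModel.exists_centre_mulEquiv F E c v hcδ hδ hd hc1 w hw hJ₁
  obtain ⟨Tc, hTc, hTc_cont⟩ := hTcex
  have hχKex : ∃ χK : (v.adicCompletion F)ˣ →* ℂˣ, χK = χ.comp Tc.symm.toMonoidHom := ⟨_, rfl⟩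
  obtain ⟨χK, hχK⟩ := hχKex
  have hχK_apply : ∀ z, χK (Tc z) = χ z := fun z => by
    rw [hχK, MonoidHom.comp_apply, MulEquiv.coe_toMonoidHom, MulEquiv.symm_apply_apply]
  have hχKu : ∀ t, ‖((χK t : ℂˣ) : ℂ)‖ = 1 := fun t => by rw [hχK]; exact hχu _
  have hχKc : Continuous fun t => ((χK t : ℂˣ) : ℂ) := by rw [hχK]; exact hχc.comp hTc_cont
  have hχKo : IsOpen (χK.ker : Set (v.adicCompletion F)ˣ) := by
    have hinv : (fun t => (((χK t)⁻¹ : ℂˣ) : ℂ)) = (fun t => ((χK t : ℂˣ) : ℂ)) ∘ fun t => t⁻¹ :=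
      funext fun t => by simp only [Function.comp_apply, map_inv]
    have hcont : Continuous χK := Units.continuous_iff.2 ⟨hχKc, by rw [hinv]; exact hχKc.comp continuous_inv⟩
    exact isOpen_ker_quasiChar_holds ⟨χK, hcont⟩
  have hkey : ∀ z : localPi E c 1 J₁ v,
      localCenter E c N J J₁ hJ₁ v z = φ (Units.map (Matrix.scalar (Fin N)).toMonoidHom (Tc z)) := by
    intro z
    rw [hφ]
    refine SplitPlaceMixedModel.localCenter_eq_symm_map F E c N hcδ hδ hd v hc1 hJh w hw hJw hJ₁ z _ ?_
    rw [SchwartzPiLine.coe_scalar]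
    congr 1
    apply (toPlace v w).injective
    rw [hTc z, toPlace_splitCoord F E c hcδ hδ hd v w hw]
  -- §E the coinvariants: `Coinv(ω_s ∘ localCenter, χ) ≅ Coinv(π_K ∘ scalar ∘ T_c, χ) = Coinv(π_K ∘ scalar, χ_K)` along `Γ`
  have hc₁ : ∀ (a : GL (Fin N) (v.adicCompletion F)) (z : localPi E c 1 J₁ v), Commute (πK a)
      (((πK.comp (Units.map (Matrix.scalar (Fin N)).toMonoidHom)).comp Tc.toMonoidHom) z) := fun a z => hcomm a (Tc z)
  have hT₁ : ∀ (z : localPi E c 1 J₁ v) (Ψ : SchwartzBruhat (Fin N → v.adicCompletion F)),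
      ((πK.comp (Units.map (Matrix.scalar (Fin N)).toMonoidHom)).comp Tc.toMonoidHom) z (Γ Ψ) =
        (((fun _ => (1 : ℂˣ)) z : ℂˣ) : ℂ) •
          Γ ((((MpPsi.toRep (localSchrodinger F N T v)).comp s).comp (localCenter E c N J J₁ hJ₁ v)) z Ψ) := by
    intro z Ψ
    change πK (Units.map (Matrix.scalar (Fin N)).toMonoidHom (Tc z)) (Γ Ψ) =
      ((1 : ℂˣ) : ℂ) • Γ ((MpPsi.toRep (localSchrodinger F N T v)).comp s (localCenter E c N J J₁ hJ₁ v z) Ψ)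
    rw [Units.val_one, one_smul, hπK, LinearEquiv.symm_apply_apply, hkey]
  have hχ₁ : ∀ z : localPi E c 1 J₁ v, χ z = (fun _ => (1 : ℂˣ)) z * χ z := fun z => (one_mul _).symm
  have hker : TwistedCoinv.ker ((πK.comp (Units.map (Matrix.scalar (Fin N)).toMonoidHom)).comp Tc.toMonoidHom) χ =
      TwistedCoinv.ker (πK.comp (Units.map (Matrix.scalar (Fin N)).toMonoidHom)) χK := by
    unfold TwistedCoinv.ker
    congr 1
    ext u
    simp only [Set.mem_range, Prod.exists]
    constructor
    · rintro ⟨z, Ψ, rfl⟩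
      exact ⟨Tc z, Ψ, by rw [hχK_apply]; rfl⟩
    · rintro ⟨t, Ψ, rfl⟩
      refine ⟨Tc.symm t, Ψ, ?_⟩
      change πK (Units.map (Matrix.scalar (Fin N)).toMonoidHom (Tc (Tc.symm t))) Ψ - ((χ (Tc.symm t) : ℂˣ) : ℂ) • Ψ =
        πK (Units.map (Matrix.scalar (Fin N)).toMonoidHom t) Ψ - ((χK t : ℂˣ) : ℂ) • Ψ
      rw [← hχK_apply (Tc.symm t), MulEquiv.apply_symm_apply]
  -- §F irreducibility [Zelevinsky1980, Thm. 4.2] and the `F_v`-model [MVW, III.7 a)]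
  haveI : BorelSpace (v.adicCompletion F)ˣ := Units.borelSpace
  have hχ''u : ∀ t, ‖(((χK * νK ^ (1 - (N : ℤ))) t : ℂˣ) : ℂ)‖ = 1 := fun t => by
    rw [MonoidHom.mul_apply, MonoidHom.zpow_apply, Units.val_mul, Units.val_zpow_eq_zpow_val, norm_mul, norm_zpow,
      hχKu, hνKu, _root_.one_zpow, mul_one]
  have hχ''c : Continuous fun t => (((χK * νK ^ (1 - (N : ℤ))) t : ℂˣ) : ℂ) := by
    have : (fun t => (((χK * νK ^ (1 - (N : ℤ))) t : ℂˣ) : ℂ)) =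
        fun t => ((χK t : ℂˣ) : ℂ) * (((νK t : ℂˣ) : ℂ) ^ (1 - (N : ℤ))) := by
      funext t
      rw [MonoidHom.mul_apply, MonoidHom.zpow_apply, Units.val_mul, Units.val_zpow_eq_zpow_val]
    rw [this]
    refine hχKc.mul (hνKc.zpow₀ _ fun t => Or.inl ?_)
    exact Units.ne_zero _
  have hirr := parabolicIndGL_detChar_unitary_isIrreducible_holds.{0} (v.adicCompletion F) N νK (χK * νK ^ (1 - (N : ℤ))) hνKu hνKc hχ''u hχ''c
  have hΘBex := SchwartzPiLine.exists_equiv_parabolicIndGL πK νK χK hπK_model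
    (Measure.haar : Measure (v.adicCompletion F)ˣ) hN1 hνKo hνKu hχKo hχKu hπKs hcomm hirr
  obtain ⟨ΘB, hΘB⟩ := hΘBex
  have hχ'ex : ∃ χ' : (w.1.adicCompletion E)ˣ →* ℂˣ,
      χ' = χK.comp (Units.map (ιw.symm : w.1.adicCompletion E →+* v.adicCompletion F).toMonoidHom) := ⟨_, rfl⟩
  obtain ⟨χ', hχ'⟩ := hχ'ex
  have hχ'_apply : ∀ t, χ' (Units.map (ιw : v.adicCompletion F →+* w.1.adicCompletion E).toMonoidHom t) = χK t :=
    fun t => by rw [hχ', MonoidHom.comp_apply, hmap_symm]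
  have e2 : (χ' * ν ^ (1 - (N : ℤ))).comp (Units.map (ιw : v.adicCompletion F →+* w.1.adicCompletion E).toMonoidHom) =
      χK * νK ^ (1 - (N : ℤ)) :=
    MonoidHom.ext fun t => by
      rw [MonoidHom.comp_apply, MonoidHom.mul_apply, MonoidHom.mul_apply, MonoidHom.zpow_apply, MonoidHom.zpow_apply,
        hν_apply, hχ'_apply]
  have hT := exists_equiv_parabolicIndGL_map_of_eq ιw hιc hιc' ν χ' νK (χK * νK ^ (1 - (N : ℤ))) e1 e2
  obtain ⟨Φ, Ψ, hΦ, hΨ⟩ := hT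
  have hχ'u : ∀ x, ‖((χ' x : ℂˣ) : ℂ)‖ = 1 := fun x => by rw [hχ']; exact hχKu _
  have hχ'c : Continuous fun x => ((χ' x : ℂˣ) : ℂ) := by
    rw [hχ']; exact hχKc.comp (Continuous.units_map _ hιc')
  refine ⟨χ', hχ'u, hχ'c, ?_⟩
  -- §H the composite isomorphism and its equivariance
  have h2 : ∀ Ψ₁ : SchwartzBruhat (Fin N → v.adicCompletion F),
      Submodule.quotEquivOfEq _ _ hker (TwistedCoinv.mk
        ((πK.comp (Units.map (Matrix.scalar (Fin N)).toMonoidHom)).comp Tc.toMonoidHom) χ Ψ₁) =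
        TwistedCoinv.mk (πK.comp (Units.map (Matrix.scalar (Fin N)).toMonoidHom)) χK Ψ₁ := fun Ψ₁ => rfl
  have hΘB' : ∀ (a : GL (Fin N) (v.adicCompletion F)) (Ψ₁ : SchwartzBruhat (Fin N → v.adicCompletion F)),
      ΘB (TwistedCoinv.mk (πK.comp (Units.map (Matrix.scalar (Fin N)).toMonoidHom)) χK (πK a Ψ₁)) =
        Representation.parabolicIndGL (v.adicCompletion F) (lastBlockLabel N)
          ((Representation.trivial ℂ (Π b : Bool, GL {i : Fin N // lastBlockLabel N i = b} (v.adicCompletion F)) ℂ).twist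
            (maxParabolicLeviChar (v.adicCompletion F) N νK (χK * νK ^ (1 - (N : ℤ))))) a
          (ΘB (TwistedCoinv.mk (πK.comp (Units.map (Matrix.scalar (Fin N)).toMonoidHom)) χK Ψ₁)) := by
    intro a Ψ₁
    rw [← hΘB a, TwistedCoinv.rep_mk]
  have HC : ∀ (g : localPi E c N J v) (z : localPi E c 1 J₁ v),
      Commute (((MpPsi.toRep (localSchrodinger F N T v)).comp s) g)
        ((((MpPsi.toRep (localSchrodinger F N T v)).comp s).comp (localCenter E c N J J₁ hJ₁ v)) z) :=
    fun g z => (show Commute g (localCenter E c N J J₁ hJ₁ v z) from localCenter_comm E c N J J₁ hJ₁ v z g).map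
      ((MpPsi.toRep (localSchrodinger F N T v)).comp s)
  have hΘcex : ∃ Θc : TwistedCoinv.Coinv (((MpPsi.toRep (localSchrodinger F N T v)).comp s).comp
      (localCenter E c N J J₁ hJ₁ v)) χ ≃ₗ[ℂ] _, ∀ y, Θc y = ((((TwistedCoinv.mapEquiv _ χ _ χ Γ (fun _ => (1 : ℂˣ)) hT₁ hχ₁).trans
      (Submodule.quotEquivOfEq _ _ hker)).trans ΘB).trans Ψ) y := ⟨_, fun _ => rfl⟩
  obtain ⟨Θc, hΘc⟩ := hΘcex
  have hΘc_mk : ∀ Ψ₁ : SchwartzBruhat (Fin N → v.adicCompletion F),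
      Θc (TwistedCoinv.mk _ χ Ψ₁) = Ψ (ΘB (TwistedCoinv.mk (πK.comp (Units.map (Matrix.scalar (Fin N)).toMonoidHom)) χK (Γ Ψ₁))) := by
    intro Ψ₁
    rw [hΘc, LinearEquiv.trans_apply, LinearEquiv.trans_apply, LinearEquiv.trans_apply, TwistedCoinv.mapEquiv_mk, h2]
  refine ⟨Θc, fun g x => ?_⟩
  have hgex := Φ.surjective g
  obtain ⟨a, rfl⟩ := hgex
  have hga : Matrix.GeneralLinearGroup.map (toPlace v w) a = Φ a := by
    rw [hΦ]
    exact Units.ext (Matrix.ext fun i j => (hιw _).symm)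
  have heΦ : (localPiSplitEquiv c J hc1 hJh w hw hJw).symm.toMonoidHom (Φ a) = φ a :=
    ((congrArg ((localPiSplitEquiv c J hc1 hJh w hw hJw).symm : _ → localPi E c N J v) hga).symm.trans (hφ a).symm)
  have hxex := TwistedCoinv.mk_surjective _ χ x
  obtain ⟨Ψ₀, rfl⟩ := hxex
  have h3 : Γ ((MpPsi.toRep (localSchrodinger F N T v)).comp s (φ a) Ψ₀) = πK a (Γ Ψ₀) := by
    rw [hπK, LinearEquiv.symm_apply_apply]
  have lhs_eq : ((TwistedCoinv.rep χ ((MpPsi.toRep (localSchrodinger F N T v)).comp s) HC).comp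
      (localPiSplitEquiv c J hc1 hJh w hw hJw).symm.toMonoidHom) (Φ a)
      (TwistedCoinv.mk (((MpPsi.toRep (localSchrodinger F N T v)).comp s).comp (localCenter E c N J J₁ hJ₁ v)) χ Ψ₀) =
      TwistedCoinv.mk (((MpPsi.toRep (localSchrodinger F N T v)).comp s).comp (localCenter E c N J J₁ hJ₁ v)) χ
        (((MpPsi.toRep (localSchrodinger F N T v)).comp s) (φ a) Ψ₀) :=
    ((LinearMap.congr_fun (MonoidHom.comp_apply
        (TwistedCoinv.rep χ ((MpPsi.toRep (localSchrodinger F N T v)).comp s) HC)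
        (localPiSplitEquiv c J hc1 hJh w hw hJw).symm.toMonoidHom (Φ a)) _).trans
      (TwistedCoinv.rep_mk χ _ HC _ Ψ₀)).trans
      (congrArg (fun y => TwistedCoinv.mk (((MpPsi.toRep (localSchrodinger F N T v)).comp s).comp
        (localCenter E c N J J₁ hJ₁ v)) χ (((MpPsi.toRep (localSchrodinger F N T v)).comp s) y Ψ₀)) heΦ)
  exact (congrArg Θc lhs_eq).trans (((hΘc_mk _).trans ((congrArg (fun y => Ψ (ΘB
    (TwistedCoinv.mk (πK.comp (Units.map (Matrix.scalar (Fin N)).toMonoidHom)) χK y))) h3).trans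
    ((congrArg Ψ (hΘB' a (Γ Ψ₀))).trans (hΨ a _)))).trans
    (congrArg (Representation.parabolicIndGL (w.1.adicCompletion E) (lastBlockLabel N)
      ((Representation.trivial ℂ (Π b : Bool, GL {i : Fin N // lastBlockLabel N i = b} (w.1.adicCompletion E)) ℂ).twist
        (maxParabolicLeviChar (w.1.adicCompletion E) N ν (χ' * ν ^ (1 - (N : ℤ))))) (Φ a)) (hΘc_mk Ψ₀).symm))

/-- **[Liu2021, App. D, proof of Lemma D.1, first paragraph, p. 126] — the named fact `splitPlace_chiCoinv_iso_parabolicIndGL`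
HOLDS** (unconditionally: the irreducibility input [Zelevinsky1980, Thm. 4.2] is the tree's
`Zelevinsky1980.parabolicIndGL_detChar_unitary_isIrreducible_holds`).
[cite: Liu2021, App. D, proof of Lemma D.1 (first paragraph), p. 126; MoeglinVignerasWaldspurger1987, Chap. 3 III.7 a)] -/
theorem splitPlace_chiCoinv_iso_parabolicIndGL_holds : splitPlace_chiCoinv_iso_parabolicIndGL :=
  splitPlace_chiCoinv_iso_parabolicIndGL_of_isIrreducible parabolicIndGL_detChar_unitary_isIrreducible_holds

end Literature.NumberTheory.Automorphic.Liu2021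

end
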